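import Mathlib
import Summits.ValiantsHypothesis.ValiantsHypothesis.Theorems.FifoMatchingNNDivisionHardGrandResidualFibreDim
import Summits.ValiantsHypothesis.ValiantsHypothesis.Theorems.FifoMatchingNNDivisionHardCofactorComplexityLowerBound
import HarnessLib

/-!
# Route FifoMatching — crux `NNDivisionHard` (stmt-ValiantsHypothesis-21181): the residual of record gains
# «THE COFACTOR IS EXPENSIVE» — `n < (2 L₊(h) + 1)(log₂ n)^{6(c+18)+1}` — by name

`…CofactorComplexityLowerBound` (✓ p834424): `dim Newt(h) ≤ 2 L₊(h)`, so cofactors of monotone complexity `≤ n/(log₂ n)^k` are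
not certificates.  Here the exponent is made explicit (`k = 6(c+18)+1`, `cheapCofactor_not_certificate_qp_explicit`) so that
the conjunct can join the by-name residual of record `…GrandResidualFibreDim.nnDivisionHard_iff_grandResidualFibreDim`
(✓ p834446) at every level `(k, c)`:

* ★ BY NAME `nnDivisionHard_iff_grandResidualExpensive` — **`Theses.FifoMatching.NNDivisionHard` ⟺ for all `k c`, eventually in
  `n`, every `h ≠ 0` that is cheap (`L₊(h) ≤ 2^((log₂ n + c)^c)`) AND EXPENSIVE (`n < (2 L₊(h) + 1)(log₂ n)^{6(c+18)+1}`),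
  torus-homogeneous, window-dense, deep, spread, undominated, bounded-arc non-generic, of high Newton dimension and of high fibre
  dimension on every product face, satisfies `2^((log₂ n + c)^c) < L₊(NN_n · h) + L₊(h)`.**

HONEST FRAMING: residual book-keeping BY NAME; `NNDivisionHard`, `NNNotVP`, VP ≠ VNP stay OPEN (NOT proved).  No definitions,
no named facts.  References: Hrubeš–Yehudayoff 2021 §6 Problem 2 [HrubesYehudayoff2021]; Bürgisser 2000 Def. 2.1 [Burgisser2000].
-/

noncomputable section

-- Sub = Summit single-conjunct layout: the duplicated namespace component is mandated by the tree.
set_option linter.dupNamespace false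
set_option autoImplicit false

namespace Summit.ValiantsHypothesis.ValiantsHypothesis.Theorems.FifoMatching.NNDivisionHard.GrandResidualExpensive

open MvPolynomial Finset Literature.Computability.AlgebraicComplexity
open scoped NNReal BigOperators Classical
open Summit.ValiantsHypothesis.ValiantsHypothesis.Theorems.ZeroOneTransfer.Negative (topComponent)
open Summit.ValiantsHypothesis.ValiantsHypothesis.Theorems.FifoMatching.NNLowDegreeCofactorHard (vertexDeg)
open Summit.ValiantsHypothesis.ValiantsHypothesis.Theorems.FifoMatching.NNNotVP.DivisionSplit (σ NN SuppFn freeVars)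
open Summit.ValiantsHypothesis.ValiantsHypothesis.Theorems.FifoMatching.NNDivisionHard.GrandResidualFibreDim
  (nnDivisionHard_iff_grandResidualFibreDim)
open Summit.ValiantsHypothesis.ValiantsHypothesis.Theorems.FifoMatching.NNDivisionHard.PolylogArcFaces
  (polylogNewtonDim_not_certificate_qp polylog_absorb)
open Summit.ValiantsHypothesis.ValiantsHypothesis.Theorems.FifoMatching.NNDivisionHard.CofactorComplexityLowerBound
  (finrank_vectorSpan_support_le_two_mul_complexity)

/-- ★★ **Cheap cofactors are not certificates, explicit exponent**: for every `c`, eventually in `n`, every `h ≠ 0` with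
`(2 L₊(h) + 1)(log₂ n)^{6(c+18)+1} ≤ n` satisfies `2^((log₂ n + c)^c) < L₊(NN_n · h) + L₊(h)`.
[cite: HrubesYehudayoff2021, §6 Problem 2] [cite: Burgisser2000, Def. 2.1] -/
theorem cheapCofactor_not_certificate_qp_explicit (c : ℕ) : ∃ n₀ : ℕ, ∀ n : ℕ, n₀ ≤ n →
    ∀ h : MvPolynomial (Fin (2 * n) × Fin (2 * n)) ℝ≥0, h ≠ 0 →
      (2 * complexity h + 1) * (Nat.log 2 n) ^ (6 * (c + 18) + 1) ≤ n →
      2 ^ ((Nat.log 2 n + c) ^ c) < complexity (nestFreeMatchingPoly n ℝ≥0 * h) + complexity h := by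
  obtain ⟨n₀, hn₀⟩ := polylogNewtonDim_not_certificate_qp c
  obtain ⟨l₀, hl₀⟩ := polylog_absorb c
  refine ⟨max n₀ (2 ^ l₀), fun n hn h hh hL => hn₀ n (le_trans (le_max_left _ _) hn) h hh ?_⟩
  have hn' : 2 ^ l₀ ≤ n := le_trans (le_max_right _ _) hn
  have hl : l₀ ≤ Nat.log 2 n :=
    (Nat.le_log_iff_pow_le one_lt_two (by have := Nat.one_le_two_pow (n := l₀); omega)).2 hn'
  have hD := finrank_vectorSpan_support_le_two_mul_complexity h
  set D := Module.finrank ℚ (vectorSpan ℚ ((fun u : (Fin (2 * n) × Fin (2 * n)) →₀ ℕ =>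
        fun a : Fin (2 * n) × Fin (2 * n) => (u a : ℚ)) '' (h.support : Set ((Fin (2 * n) × Fin (2 * n)) →₀ ℕ))))
    with hDdef
  calc 2 * (D + 1) * ((Nat.log 2 n + (c + 18)) ^ (6 * (c + 18)) + 3)
      = (D + 1) * (2 * ((Nat.log 2 n + (c + 18)) ^ (6 * (c + 18)) + 3)) := by
        rw [Nat.mul_comm 2 (D + 1), Nat.mul_assoc]
    _ ≤ (2 * complexity h + 1) * (Nat.log 2 n) ^ (6 * (c + 18) + 1) :=
        Nat.mul_le_mul (Nat.add_le_add_right hD 1) (hl₀ _ hl)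
    _ ≤ n := hL

/-- ★ **BY NAME: `NNDivisionHard` ⟺ grand residual ∧ bounded-arc-set non-generic ∧ high Newton dimension ∧ high fibre
dimension ∧ EXPENSIVE COFACTOR.** [cite: HrubesYehudayoff2021, §6 Problem 2] -/
theorem nnDivisionHard_iff_grandResidualExpensive :
    Summit.ValiantsHypothesis.ValiantsHypothesis.Theses.FifoMatching.NNDivisionHard ↔
      ∀ k c : ℕ, ∃ n₀ : ℕ, ∀ n ≥ n₀, ∀ h : MvPolynomial (Fin (2 * n) × Fin (2 * n)) ℝ≥0, h ≠ 0 →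
        complexity h ≤ 2 ^ ((Nat.log 2 n + c) ^ c) →
        n < (2 * complexity h + 1) * (Nat.log 2 n) ^ (6 * (c + 18) + 1) →
        (∀ d ∈ h.support, ∀ d' ∈ h.support, vertexDeg d = vertexDeg d') →
        (∀ d ∈ h.support, ∀ s : ℕ,
          s + (2 * ((Nat.log 2 n + c) ^ c + Nat.log 2 n + 1) ^ 6 + 12) ≤ 2 * n →
          ∃ e ∈ d.support,
            (s ≤ e.1.val ∧ e.1.val < s + (2 * ((Nat.log 2 n + c) ^ c + Nat.log 2 n + 1) ^ 6 + 12)) ∨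
            (s ≤ e.2.val ∧ e.2.val < s + (2 * ((Nat.log 2 n + c) ^ c + Nat.log 2 n + 1) ^ 6 + 12))) →
        (∀ e : ℕ, e ≤ 2 ^ ((Nat.log 2 n + k) ^ k) → homogeneousComponent e h = 0) →
        (∀ d ∈ h.support, (Nat.log 2 n + k) ^ k < d.support.card) →
        (∀ T : Finset (σ n), T.card ≤ (Nat.log 2 n + k) ^ k →
          ∃ A : Finset (σ n), SuppFn (freeVars T (NN n)) A ∧ ¬ SuppFn (freeVars T h) A) →
        (∀ I : Finset (Fin (2 * n) × Fin (2 * n)), I.card ≤ k →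
          ∀ (d : (Fin (2 * n) × Fin (2 * n)) →₀ ℕ) (a : ℝ≥0), a ≠ 0 →
            topComponent (fun v : Fin (2 * n) × Fin (2 * n) => if v ∈ I then 0 else 1) h ≠ monomial d a) →
        n < (Module.finrank ℚ (vectorSpan ℚ ((fun u : (Fin (2 * n) × Fin (2 * n)) →₀ ℕ =>
          fun a : Fin (2 * n) × Fin (2 * n) => (u a : ℚ)) '' (h.support : Set ((Fin (2 * n) × Fin (2 * n)) →₀ ℕ))))
          + 1) ^ 2 →
        (∀ b : ℕ, b ≤ n → ∀ (ι : Fin (2 * b) × Fin (2 * b) → Fin (2 * n) × Fin (2 * n)), Function.Injective ι →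
          ∀ (w : Fin (2 * n) × Fin (2 * n) → ℕ) (S : MvPolynomial (Fin (2 * n) × Fin (2 * n)) ℝ≥0),
            topComponent w (nestFreeMatchingPoly n ℝ≥0) = rename ι (nestFreeMatchingPoly b ℝ≥0) * S → S ≠ 0 →
            (∀ m ∈ S.support, ∀ e ∈ m.support, e ∉ Set.range ι) →
            b < 2 * (Module.finrank ℚ (vectorSpan ℚ ((fun u : (Fin (2 * n) × Fin (2 * n)) →₀ ℕ =>
              fun t : Fin (2 * b) × Fin (2 * b) => (u (ι t) : ℚ)) ''
                ((topComponent w h).support : Set ((Fin (2 * n) × Fin (2 * n)) →₀ ℕ)))) + 1) *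
              ((Nat.log 2 n + (c + 1 + 18)) ^ (6 * (c + 1 + 18)) + 3)) →
        2 ^ ((Nat.log 2 n + c) ^ c) <
          complexity (nestFreeMatchingPoly n ℝ≥0 * h) + complexity h := by
  constructor
  · intro H k c
    obtain ⟨n₀, hn₀⟩ := H c
    exact ⟨n₀, fun n hn h hh _ _ _ _ _ _ _ _ _ _ => hn₀ n hn h hh⟩
  · intro H
    refine nnDivisionHard_iff_grandResidualFibreDim.mpr fun k c => ?_
    obtain ⟨n₀, hn₀⟩ := H k c
    obtain ⟨n₁, hn₁⟩ := cheapCofactor_not_certificate_qp_explicit c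
    refine ⟨max n₀ n₁, fun n hn h hh hcheap htor hdense hdeep hspread hund hgen hdim hfib => ?_⟩
    by_cases hexp : (2 * complexity h + 1) * (Nat.log 2 n) ^ (6 * (c + 18) + 1) ≤ n
    · exact hn₁ n (le_trans (le_max_right _ _) hn) h hh hexp
    · exact hn₀ n (le_trans (le_max_left _ _) hn) h hh hcheap (not_le.1 hexp) htor hdense hdeep hspread hund hgen hdim
        hfib

end Summit.ValiantsHypothesis.ValiantsHypothesis.Theorems.FifoMatching.NNDivisionHard.GrandResidualExpensive

end
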